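import Summits.KontsevichZagierPeriods.KontsevichZagierPeriods.Theses.SymplecticScissors
import Literature.NumberTheory.Transcendental.AyoubPeriodSeries
import Literature.NumberTheory.Transcendental.AyoubPeriodSeriesKernel
import Literature.NumberTheory.Transcendental.AyoubPeriodSeriesPiAlgebraic
import Summits.KontsevichZagierPeriods.KontsevichZagierPeriods.Theorems.UnfoldedStokesStokesGenerationStubSpanToRepsAuxCoeff
import Mathlib.RingTheory.MvPowerSeries.Rename
import Mathlib.RingTheory.MvPowerSeries.Substitution
import Mathlib.RingTheory.MvPowerSeries.Inverse
import Mathlib.RingTheory.PowerSeries.Basic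
import Summits.KontsevichZagierPeriods.KontsevichZagierPeriods.Theorems.SymplecticScissorsTypeAGenerationStubRestrCOneAux
import Summits.KontsevichZagierPeriods.KontsevichZagierPeriods.Theorems.SymplecticScissorsTypeAGenerationStubSubstRoom

/-!
# `TypeAGeneration` (stmt-KontsevichZagierPeriods-18392), line `Sketch`, stub `stub_weightedNormMul`
(U0): the weighted `ℓ¹` norm on `ℂ[[z₀, z₁, …]]` is submultiplicative

Registered stub `stub_weightedNormMul` of the crux `TypeAGeneration` (route SymplecticScissors,
line `Sketch` = card stokes-compiler), on top of
`Literature/NumberTheory/Transcendental/AyoubPeriodSeries.lean` (`AyoubRel.CSeries = ℂ[[z₀, z₁, …]]`)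
and of the sibling stub files `SymplecticScissorsTypeAGenerationStubRestrCOneAux.lean` (the weight
`ρ^a = ∏_l ρ_l^{a_l}` is multiplicative, `s4_weight_add`) and
`SymplecticScissorsTypeAGenerationStubSubstRoom.lean` (`ρ^a ≥ 0` for `ρ ≥ 0`, `s3_wprod_nonneg`).

For weights `ρ : ℕ → ℝ`, `ρ ≥ 0`, the weighted `ℓ¹` "norm" `N_ρ(F) = Σ_a ‖F_a‖ ρ^a` satisfies
`N_ρ(F G) ≤ N_ρ(F) N_ρ(G)` (unit lemma U0 of the cycle-3 chain; U1a/U1b take it as a hypothesis):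

* termwise, `‖(F G)_c‖ ρ^c ≤ Σ_{a + b = c} (‖F_a‖ ρ^a) (‖G_b‖ ρ^b)`
  (`u0_norm_coeff_mul_weight_le`: `(F G)_c = Σ_{a + b = c} F_a G_b` and `ρ^{a + b} = ρ^a ρ^b`);
* the right-hand side is the `c`-th term of the Cauchy product, over the antidiagonals of
  `ℕ →₀ ℕ`, of the two non-negative summable families `‖F_a‖ ρ^a` and `‖G_b‖ ρ^b`, which sums to
  `N_ρ(F) N_ρ(G)` (`u0_hasSum_cauchy`, Mathlib's `Summable.tsum_mul_tsum_eq_tsum_sum_antidiagonal`);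
* comparison of non-negative families (`stub_weightedNormMul`, stated in `HasSum` form).

Elementary (folklore); no definition is introduced.
-/

noncomputable section

-- `Summit.KontsevichZagierPeriods.KontsevichZagierPeriods.…` is the tree's mandated layout (single-conjunct summit).
set_option linter.dupNamespace false

namespace Summit.KontsevichZagierPeriods.KontsevichZagierPeriods.TypeAGenerationLine

open Finsupp MvPowerSeries
open Literature.NumberTheory.Transcendental
open Literature.NumberTheory.Transcendental.AyoubRel
open Summit.KontsevichZagierPeriods.KontsevichZagierPeriods.Theses.SymplecticScissors (TypeAGeneration)

/-- **Termwise bound**: `‖(F G)_c‖ ρ^c ≤ Σ_{a + b = c} (‖F_a‖ ρ^a) (‖G_b‖ ρ^b)` for `ρ ≥ 0`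
(`(F G)_c = Σ_{a + b = c} F_a G_b`, the triangle inequality, and `ρ^c = ρ^a ρ^b` on the
antidiagonal `a + b = c`). [folklore] -/
theorem u0_norm_coeff_mul_weight_le (F G : CSeries) {ρ : ℕ → ℝ} (hρ : ∀ l, 0 ≤ ρ l)
    (c : ℕ →₀ ℕ) :
    ‖coeff c (F * G)‖ * (c.prod fun l n => ρ l ^ n) ≤
      ∑ kl ∈ Finset.HasAntidiagonal.antidiagonal c,
        (‖coeff kl.1 F‖ * kl.1.prod fun l n => ρ l ^ n) *
          (‖coeff kl.2 G‖ * kl.2.prod fun l n => ρ l ^ n) := by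
  rw [coeff_mul]
  calc ‖∑ kl ∈ Finset.HasAntidiagonal.antidiagonal c, coeff kl.1 F * coeff kl.2 G‖ *
        (c.prod fun l n => ρ l ^ n)
      ≤ (∑ kl ∈ Finset.HasAntidiagonal.antidiagonal c, ‖coeff kl.1 F * coeff kl.2 G‖) *
          (c.prod fun l n => ρ l ^ n) :=
        mul_le_mul_of_nonneg_right (norm_sum_le _ _) (s3_wprod_nonneg hρ c)
    _ = ∑ kl ∈ Finset.HasAntidiagonal.antidiagonal c,
          ‖coeff kl.1 F * coeff kl.2 G‖ * (c.prod fun l n => ρ l ^ n) := Finset.sum_mul _ _ _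
    _ = ∑ kl ∈ Finset.HasAntidiagonal.antidiagonal c,
          (‖coeff kl.1 F‖ * kl.1.prod fun l n => ρ l ^ n) *
            (‖coeff kl.2 G‖ * kl.2.prod fun l n => ρ l ^ n) := by
        refine Finset.sum_congr rfl fun kl hkl => ?_
        rw [Finset.HasAntidiagonal.mem_antidiagonal] at hkl
        rw [norm_mul, ← hkl, s4_weight_add]
        ring

/-- **The Cauchy product over `ℕ →₀ ℕ` of two non-negative summable real families**: if
`Σ_a f_a = A` and `Σ_b g_b = B` with `f, g ≥ 0`, then `Σ_c Σ_{a + b = c} f_a g_b = A B` (the product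
family `f_a g_b` is summable on `(ℕ →₀ ℕ) × (ℕ →₀ ℕ)` by non-negativity, and is regrouped along
the finite antidiagonals). [folklore] -/
theorem u0_hasSum_cauchy {f g : (ℕ →₀ ℕ) → ℝ} (hf0 : ∀ a, 0 ≤ f a) (hg0 : ∀ b, 0 ≤ g b)
    {A B : ℝ} (hA : HasSum f A) (hB : HasSum g B) :
    HasSum (fun c : ℕ →₀ ℕ =>
      ∑ kl ∈ Finset.HasAntidiagonal.antidiagonal c, f kl.1 * g kl.2) (A * B) := by
  have hprod : Summable fun x : (ℕ →₀ ℕ) × (ℕ →₀ ℕ) => f x.1 * g x.2 :=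
    hA.summable.mul_of_nonneg hB.summable hf0 hg0
  have he : ∑' c : ℕ →₀ ℕ, ∑ kl ∈ Finset.HasAntidiagonal.antidiagonal c, f kl.1 * g kl.2 =
      A * B := by
    rw [← hA.summable.tsum_mul_tsum_eq_tsum_sum_antidiagonal hB.summable hprod, hA.tsum_eq,
      hB.tsum_eq]
  rw [← he]
  exact (summable_sum_mul_antidiagonal_of_summable_mul hprod).hasSum

/-- **U0 — the weighted `ℓ¹` norm is submultiplicative**: for weights `ρ ≥ 0`, if
`Σ_a ‖F_a‖ ρ^a = A` and `Σ_a ‖G_a‖ ρ^a = B` then `Σ_a ‖(F G)_a‖ ρ^a = P` for some `P ≤ A B`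
(`N_ρ(F G) ≤ N_ρ(F) N_ρ(G)`; termwise bound `u0_norm_coeff_mul_weight_le` against the Cauchy
product `u0_hasSum_cauchy`, comparison of non-negative families). Registered stub
`stub_weightedNormMul` of the crux stmt-KontsevichZagierPeriods-18392, line `Sketch`. [folklore] -/
theorem stub_weightedNormMul :
    ∀ (F G : CSeries) (ρ : ℕ → ℝ), (∀ l, 0 ≤ ρ l) →
      ∀ (A B : ℝ),
        HasSum (fun a : ℕ →₀ ℕ => ‖MvPowerSeries.coeff a F‖ * a.prod fun l n => ρ l ^ n) A →
        HasSum (fun a : ℕ →₀ ℕ => ‖MvPowerSeries.coeff a G‖ * a.prod fun l n => ρ l ^ n) B →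
        ∃ P : ℝ, P ≤ A * B ∧
          HasSum (fun a : ℕ →₀ ℕ => ‖MvPowerSeries.coeff a (F * G)‖ * a.prod fun l n => ρ l ^ n) P := by
  intro F G ρ hρ A B hA hB
  have h0 : ∀ (H : CSeries) (a : ℕ →₀ ℕ), 0 ≤ ‖coeff a H‖ * a.prod fun l n => ρ l ^ n :=
    fun H a => mul_nonneg (norm_nonneg _) (s3_wprod_nonneg hρ a)
  have hC := u0_hasSum_cauchy (h0 F) (h0 G) hA hB
  have hle := u0_norm_coeff_mul_weight_le F G hρ
  have hS : Summable fun a : ℕ →₀ ℕ => ‖coeff a (F * G)‖ * a.prod fun l n => ρ l ^ n :=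
    hC.summable.of_nonneg_of_le (h0 (F * G)) hle
  exact ⟨_, hasSum_le hle hS.hasSum hC, hS.hasSum⟩

end Summit.KontsevichZagierPeriods.KontsevichZagierPeriods.TypeAGenerationLine
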